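import Summits.MatrixMultiplication.OmegaCensus.SmallFormats.MatMul22nRankGF5XCapParityData
import HarnessLib

/-!
# ω-census family (a): `decide` checks of the rectangle-parity identities of the X-cap system over `𝔽₅` (part 1: rectangles `0 … 74`)

Cell `pub-omega` (unit `pub-omega-tensor-g11`), topic `Summits/MatrixMultiplication/OmegaCensus` (sub-folder `SmallFormats`).
Framing (verbatim): lottery ticket; floor = certified bounds/negative ranges. HONEST FRAMING: machine checks of DATA
(`MatMul22nRankGF5XCapParityData`), no mathematics: for the rectangles `i` of this part and every variable `j < 157`, the multipliers
`cp5 i − cm5 i` on the tangent rows combine the columns of `xcapSys5` into `2·ps5 i j + [j is one of the four rank-one classes of the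
rectangle] + 4·[j = 156]` (`parId5`). Chunks of 15 rectangles per `decide` (kernel memory). Consumer: the parity lemma
`MatMul22nRankGF5XCapParity`. Nothing here is progress on `ω`.
-/

namespace Summit.MatrixMultiplication.OmegaCensus.SmallFormats

/-- The column identity of rectangle `i` at variable `j`: `∑_r (cp5 i r − cm5 i r)·A r j = 2·ps5 i j + [j ∈ quadruple i] + 4·[j = 156]`. -/
def parId5 (i j : ℕ) : Prop :=
  xcapSys5.yA (cp5 i) j - xcapSys5.yA (cm5 i) j =
    2 * ps5 i j + (if j = rqv5 i 0 then 1 else 0) + (if j = rqv5 i 1 then 1 else 0) + (if j = rqv5 i 2 then 1 else 0) +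
      (if j = rqv5 i 3 then 1 else 0) + (if j = 156 then 4 else 0)

/-- `parId5 i j` is a decidable integer identity. -/
instance (i j : ℕ) : Decidable (parId5 i j) := by unfold parId5; infer_instance

set_option maxRecDepth 100000 in
set_option maxHeartbeats 4000000 in
/-- Column identities, rectangles `0 … 14`. -/
theorem parId5_c0 : ∀ i : Fin 225, i.val < 15 → ∀ j : Fin 157, parId5 i.val j.val := by decide +kernel

set_option maxRecDepth 100000 in
set_option maxHeartbeats 4000000 in
/-- Column identities, rectangles `15 … 29`. -/
theorem parId5_c1 : ∀ i : Fin 225, 15 ≤ i.val → i.val < 30 → ∀ j : Fin 157, parId5 i.val j.val := by decide +kernel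

set_option maxRecDepth 100000 in
set_option maxHeartbeats 4000000 in
/-- Column identities, rectangles `30 … 44`. -/
theorem parId5_c2 : ∀ i : Fin 225, 30 ≤ i.val → i.val < 45 → ∀ j : Fin 157, parId5 i.val j.val := by decide +kernel

set_option maxRecDepth 100000 in
set_option maxHeartbeats 4000000 in
/-- Column identities, rectangles `45 … 59`. -/
theorem parId5_c3 : ∀ i : Fin 225, 45 ≤ i.val → i.val < 60 → ∀ j : Fin 157, parId5 i.val j.val := by decide +kernel

set_option maxRecDepth 100000 in
set_option maxHeartbeats 4000000 in
/-- Column identities, rectangles `60 … 74`. -/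
theorem parId5_c4 : ∀ i : Fin 225, 60 ≤ i.val → i.val < 75 → ∀ j : Fin 157, parId5 i.val j.val := by decide +kernel

end Summit.MatrixMultiplication.OmegaCensus.SmallFormats
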